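import Summits.AtomisticToContinuum.HydrodynamicLimit.Theorems.AntiMazurCoboundariesCorrectorPressureDecayKiferWallRefClass
import Summits.AtomisticToContinuum.HydrodynamicLimit.Theorems.AntiMazurCoboundariesCorrectorPressureDecayKiferEntropyBound
import Summits.AtomisticToContinuum.HydrodynamicLimit.Theorems.AntiMazurCoboundariesCorrectorPressureDecayKiferEntropyBoundCore
import Summits.AtomisticToContinuum.HydrodynamicLimit.Theorems.AntiMazurCoboundariesCorrectorPressureDecayKiferActivityBound
import Summits.AtomisticToContinuum.HydrodynamicLimit.Theorems.AntiMazurCoboundariesCorrectorPressureDecayKiferCanonicalLocalLimitClosure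

/-!
# The wall with the CANONICAL LOCAL LIMIT as reference: line `FirstLemma` closes the crux without equivalence of ensembles
# (crux stmt-AtomisticToContinuum-14135 `AntiMazurCoboundaries.CorrectorPressureDecay` ("X"); lead seat c8)

Instantiating the abstract reference class of …KiferWallRefClass.lean with the CANONICAL LOCAL LIMITS
`IsCanonicalLocalLimitRef σ a θ u₀ G` (translation-invariant probability laws that are setwise local limits of the x-averaged
blown-up canonical laws `canonicalBlowUpLaw σ a θ u₀` along some sizes `N' → ∞`, …KiferCanonicalLocalLimit.lean p151154):

* `tangentEntropyWrt_localLimit_of : CanonicalBlowUpLocallyCompact → TangentEntropyBoundLocal →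
  TangentEntropyWrt IsCanonicalLocalLimitRef` (PROVED: pass to a subsequence realising the `liminf`, then to a locally
  convergent one (E1); the tangent state is a tangent state of the reindexed family; no Gibbs property, no activity bound);
* `correctorPressureDecay_of_localLimitWall : TangentTightness → TangentBias → CanonicalBlowUpLocallyCompact →
  TangentEntropyBoundLocal → EntropicBoltzmannPropertyWrt IsCanonicalLocalLimitRef → CorrectorPressureDecay` (PROVED,
  registered helper of the crux): the crux BY NAME from the two tangent THEOREMS (p144923, p143314), the compactness half (E1)
  ALONE, the local-limit entropy bound and the LOCAL-LIMIT WALL — the identification half (E2) `CanonicalLocalLimitIsGibbs`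
  (Georgii 1995 Thm 3.4) is NOT on this path;
* `entropicBoltzmannPropertyWrt_localLimit_of_tangent : EntropicBoltzmannPropertyTangent → CanonicalLocalLimitIsGibbs →
  EntropicBoltzmannPropertyWrt IsCanonicalLocalLimitRef` (PROVED, for the record): GIVEN (E2) the local-limit wall is IMPLIED
  by the registered wall (a local limit is translation-invariant, a.s. unit-hard-core and of density `σ³`, p152160/p152644,
  hence Gibbs of activity `≤ 2σ³ < z₀` by the landed single-site bound p149989) — the local-limit wall is the weaker
  commitment; (E2) only serves to recognise the reference as a Gibbs state.
-/

noncomputable section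

open MeasureTheory ProbabilityTheory Set Filter Topology
open scoped ENNReal

namespace Summit.AtomisticToContinuum.HydrodynamicLimit.Theorems.KiferCompactification

open Literature.MathematicalPhysics.KineticTheory (T3 V3 hsDiameter localGibbsLaw blowUpPoint)
open Literature.MathematicalPhysics.KineticTheory.PointProcess (laplaceFunctional specificRelEntropy windowLaw density)
open Literature.Analysis.FluidPDE (HardSphereFlow Config IsHardCore IsHardSphereGibbs IsTranslationInvariant windowSumReal)
open Literature.Analysis.FunctionSpaces (PointConfig)

/-- The reference class of CANONICAL LOCAL LIMITS at `(σ, a, θ, u₀)`: translation-invariant probability laws on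
configurations of `ℝ³ × ℝ³` that are setwise local limits (`IsCanonicalLocalLimit`) of the x-averaged blown-up canonical
hard-sphere laws `canonicalBlowUpLaw σ a θ u₀ (N' k) (Φ' k)` along SOME sizes `N' k → ∞` (by Georgii's equivalence of
ensembles these are the translation-invariant Gibbs states of density `σ³`; no such identification is built in). -/
def IsCanonicalLocalLimitRef (σ a θ : ℝ) (u₀ : V3) (G : Measure (PointConfig (V3 × V3))) : Prop :=
  IsProbabilityMeasure G ∧ IsTranslationInvariant G ∧
    ∃ (N' : ℕ → ℕ)
      (Φ' : ∀ k, HardSphereFlow (Literature.Analysis.FluidPDE.Torus.geometry (Fin 3)) (hsDiameter σ (N' k)) (N' k + 1)),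
      Tendsto N' atTop atTop ∧ IsCanonicalLocalLimit σ a θ u₀ N' Φ' G

/-! ## The canonical local limit as reference -/

/-- **Entropy input with respect to the canonical local limits, from the compactness half (E1) and the local-limit entropy
bound.** Below `min σ₂ (1/2)`: given a tangent family, a weight `φ` and a translation-invariant probability tangent state `μ`
along `ι`, take `r₀` realising `liminf_k (N(ι k)+1)⁻¹ KL(Q(ι k) ‖ G_{N(ι k)})`, then a subsequence `κ'` of `ι ∘ r₀` along
which the x-averaged blown-up canonical laws converge locally to a translation-invariant probability `G` (E1); `μ` is a
tangent state of the family reindexed by `ι ∘ r₀ ∘ κ'` (along `id`), so `TangentEntropyBoundLocal` gives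
`h(μ | G) ≤ (∫φ)⁻¹ σ³ lim_k u(r₀(κ' k)) = (∫φ)⁻¹ σ³ liminf u`; and `G ∈ IsCanonicalLocalLimitRef σ a θ u₀`. No Gibbs
property and no activity bound enter. -/
theorem tangentEntropyWrt_localLimit_of (hC : CanonicalBlowUpLocallyCompact) (hL : TangentEntropyBoundLocal) :
    TangentEntropyWrt IsCanonicalLocalLimitRef := by
  obtain ⟨σ₂, hσ₂, hL⟩ := hL
  refine ⟨min σ₂ (1 / 2), lt_min hσ₂ (by norm_num), ?_⟩
  intro σ a θ u₀ κ hσ hσlt ha hθ hκ φ hφ hφ0 hφ1 hφi N Φ Q hfam ι μ hμ hμP hμT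
  have hσ₂' : σ < σ₂ := hσlt.trans_le (min_le_left _ _)
  have hσhalf : σ ≤ 1 / 2 := (hσlt.trans_le (min_le_right _ _)).le
  -- the entropy sequence `u k ∈ [0, κ]`
  set u : ℕ → ℝ := fun k => ((N (ι k) + 1 : ℕ) : ℝ)⁻¹ *
      (InformationTheory.klDiv (Q (ι k))
        (localGibbsLaw σ (fun _ => a) (fun _ => u₀) (fun _ => θ) (N (ι k)) (Φ (ι k)))).toReal with hu
  have hu0 : ∀ k, 0 ≤ u k := fun k => mul_nonneg (inv_nonneg.2 (Nat.cast_nonneg _)) ENNReal.toReal_nonneg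
  have huκ : ∀ k, u k ≤ κ := by
    intro k
    have hKL := hfam.2.2.1 (ι k)
    have h1 : (InformationTheory.klDiv (Q (ι k))
        (localGibbsLaw σ (fun _ => a) (fun _ => u₀) (fun _ => θ) (N (ι k)) (Φ (ι k)))).toReal ≤
        κ * (N (ι k) + 1) := by
      have h := ENNReal.toReal_mono ENNReal.ofReal_ne_top hKL
      rwa [ENNReal.toReal_ofReal (by positivity)] at h
    have hn : (0 : ℝ) < ((N (ι k) + 1 : ℕ) : ℝ) := by positivity
    rw [hu]
    simp only
    rw [inv_mul_le_iff₀ hn]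
    calc _ ≤ κ * (N (ι k) + 1) := h1
      _ = ((N (ι k) + 1 : ℕ) : ℝ) * κ := by push_cast; ring
  -- Step 1: a subsequence realising the liminf
  obtain ⟨r₀, hr₀, hr₀lim⟩ := exists_strictMono_tendsto_liminf hu0 huκ
  have hι : StrictMono ι := hμ.1
  -- Step 2: a locally convergent further subsequence (E1)
  have hN' : Tendsto (fun j => N (ι (r₀ j))) atTop atTop := by
    refine tendsto_atTop_mono (fun j => ?_) tendsto_id
    exact ((hι.comp hr₀).id_le j).trans (hfam.1 _)
  obtain ⟨κ', hκ', G, hGP, hGT, -, -, hloc⟩ :=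
    hC σ a θ u₀ hσ hσhalf ha hθ (fun j => N (ι (r₀ j))) (fun j => Φ (ι (r₀ j))) hN'
  -- Step 3: the reindexed family and `μ` as its tangent state along `id`
  have hs : StrictMono fun k => ι (r₀ (κ' k)) := hι.comp (hr₀.comp hκ')
  have hfam' := isTangentFamily_reindex hfam hs
  have hμ' : IsTangentState σ φ (fun k => N (ι (r₀ (κ' k)))) (fun k => Q (ι (r₀ (κ' k)))) id μ := by
    refine ⟨strictMono_id, fun f hf hfc hf0 => ?_⟩
    exact (hμ.2 f hf hfc hf0).comp ((hr₀.comp hκ').tendsto_atTop)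
  -- Step 4: the local-limit entropy bound along the reindexed family
  have hbound := hL σ a θ u₀ κ hσ hσ₂' ha hθ hκ φ hφ hφ0 hφ1 hφi (fun k => N (ι (r₀ (κ' k))))
    (fun k => Φ (ι (r₀ (κ' k)))) (fun k => Q (ι (r₀ (κ' k)))) hfam' id μ hμ' hμP hμT G hGP hGT
    (fun Λ hΛ hΛb A hA => hloc Λ hΛ hΛb A hA)
  -- Step 5: the reference class and the value of the liminf along the sub-subsequence
  have hlim : liminf (fun k => u (r₀ (κ' k))) atTop = liminf u atTop :=
    (hr₀lim.comp hκ'.tendsto_atTop).liminf_eq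
  refine ⟨G, ⟨hGP, hGT, fun j => N (ι (r₀ (κ' j))), fun j => Φ (ι (r₀ (κ' j))), hN'.comp hκ'.tendsto_atTop, hloc⟩,
    hbound.trans (le_of_eq ?_)⟩
  rw [← hlim]
  rfl

/-- **THE CRUX FROM THE LOCAL-LIMIT WALL, WITHOUT EQUIVALENCE OF ENSEMBLES.** Tightness and bias continuity of tangent
states (THEOREMS in the tree), the compactness half (E1) of the canonical local limit, the local-limit entropy bound and
the wall with the canonical local limits as references give `CorrectorPressureDecay` BY NAME (through the landed
`stub_reduction` and `correctorPressureDecay_of_kineticFluxLdDecay`). -/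
theorem correctorPressureDecay_of_localLimitWall (hT : TangentTightness) (hB : TangentBias)
    (hC : CanonicalBlowUpLocallyCompact) (hL : TangentEntropyBoundLocal)
    (hW : EntropicBoltzmannPropertyWrt IsCanonicalLocalLimitRef) :
    Summit.AtomisticToContinuum.HydrodynamicLimit.Theses.AntiMazurCoboundaries.CorrectorPressureDecay :=
  Summit.AtomisticToContinuum.HydrodynamicLimit.Theorems.CorrectorPressureDecayEquivalences.correctorPressureDecay_of_kineticFluxLdDecay
    (stub_reduction (almostStationaryDualDecay_of_refClass IsCanonicalLocalLimitRef hT hB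
      (tangentEntropyWrt_localLimit_of hC hL) hW))

/-- **Given (E2), the local-limit wall is implied by the registered wall** (so it is the weaker commitment): a canonical
local limit along sizes `N' → ∞` at `0 < σ ≤ 1/2` is almost surely unit-hard-core and of density `σ³`
(`ae_isHardCore_of_isCanonicalLocalLimit`, `density_of_isCanonicalLocalLimit`, p152644), hence by (E2) a
translation-invariant Gibbs state `IsHardSphereGibbs 1 z θ⁻¹ u₀` for some `z > 0`, whose activity is `≤ 2σ³` by the
single-site bound `stub_activityBound` (p149989) once `σ³ ≤ 1/128`, hence `< z₀` for `σ` small: the registered wall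
applies to it. Threshold: `σw := min (1/8) (z₀/4)`. -/
theorem entropicBoltzmannPropertyWrt_localLimit_of_tangent (hW : EntropicBoltzmannPropertyTangent)
    (hG : CanonicalLocalLimitIsGibbs) : EntropicBoltzmannPropertyWrt IsCanonicalLocalLimitRef := by
  intro θ u₀ hθ
  obtain ⟨z₀, hz₀, κ, hκ, hWmain⟩ := hW θ u₀ hθ
  refine ⟨min (1 / 8) (z₀ / 4), by positivity, κ, hκ, ?_⟩
  intro σ a hσ hσw ha φ hφ hφ0 hφ1 hφi N Φ Q hfam ι μ hμ hμP hμT G hRef g hg hgκ horth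
  obtain ⟨hGP, hGT, N', Φ', hN', hloc⟩ := hRef
  have hσ8 : σ < 1 / 8 := hσw.trans_le (min_le_left _ _)
  have hσz : σ < z₀ / 4 := hσw.trans_le (min_le_right _ _)
  have hσhalf : σ ≤ 1 / 2 := by linarith
  have hGhc : ∀ᵐ ω ∂G, IsHardCore 1 ω := ae_isHardCore_of_isCanonicalLocalLimit hσ hσhalf ha hθ hloc
  have hGd : density G = ENNReal.ofReal (σ ^ 3) := density_of_isCanonicalLocalLimit hσ hσhalf ha hθ hloc
  obtain ⟨z, hz, hGibbs⟩ := hG σ a θ u₀ hσ hσhalf ha hθ N' Φ' hN' G hGP hGT hGhc hGd hloc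
  have hσ3 : σ ^ 3 ≤ 1 / 128 := by
    have h3 : σ ^ 3 ≤ (1 / 8) * (1 / 8) * (1 / 8) := by
      calc σ ^ 3 = σ * σ * σ := by ring
        _ ≤ (1 / 8) * (1 / 8) * (1 / 8) := by gcongr
    linarith
  have hz2 : z ≤ 2 * σ ^ 3 := stub_activityBound z θ u₀ G (σ ^ 3) hz hθ hGibbs hGT hGd (by positivity) hσ3
  have hzz₀ : z < z₀ := by
    have h1 : σ ^ 3 ≤ σ := by
      calc σ ^ 3 = σ * (σ * σ) := by ring
        _ ≤ σ * (1 * 1) := by gcongr <;> linarith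
        _ = σ := by ring
    linarith
  exact hWmain σ a hσ ha φ hφ hφ0 hφ1 hφi N Φ Q hfam ι μ hμ hμP hμT z G hz hzz₀ hGibbs hGT g hg hgκ horth

end Summit.AtomisticToContinuum.HydrodynamicLimit.Theorems.KiferCompactification

end
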